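import Mathlib
import Summits.FinalStateConjecture.FinalStateConjecture.Statement
import Literature.Geometry.Lorentzian.Basic
import Summits.FinalStateConjecture.FinalStateConjecture.Theorems.EIHFluxBalanceModulatedKerrHandoffTameDefs
import HarnessLib

/-!
# Line `cone-rates-are-iled`, stub S3 `stub_weightedConeDecay` (crux stmt-FinalStateConjecture-17402):
# the STRUCTURAL part of the engine — the weighted cone clause (11) from an unweighted cone RATE,
# and outright from the whole-slab clause (10) when `N = 0`

Helper file of the worker on `stub_weightedConeDecay` (`--supports stmt-FinalStateConjecture-17402`).
The engine `ConeCaptureAnsatz → WeightedConeCaptureAnsatz` asks for exactly one new clause, the crux's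
weighted `C³` cone clause

  (11) `sup_{x⁰ = t, |x̲| ≤ κt} max_{m ≤ 3} (1 + d^{7/4}) ‖D^m(Φ^*g − G)‖ → 0`, `d = min_i ‖x̲ − ξᵢ(t)‖`.

Two facts of pure bookkeeping are isolated and kernel-checked here, over the SAME `U, Φ, B, κ, ξ`:

* `weightedConeClause_of_coneRate` (every `N`): inside the cone the weight is at most
  `1 + ((κ + κ²)t)^{7/4}` eventually (clause (5): `‖ξᵢ(t)‖ ≤ κ²t`), so (11) follows from the RATE
  `(1 + ((κ + κ²)t)^{7/4}) · sup_{cone slab} max_{m ≤ 3} ‖D^m(Φ^*g − G)‖ → 0` — this unweighted-sup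
  × explicit-rate statement is precisely the analytic input missing for `N ≥ 1` (weighted Price-law
  decay `o(t^{-7/4})` in `C³` on the interior cone; Tataru arXiv:0910.5290, Metcalfe–Tataru–Tohaneanu
  arXiv:1104.5437 Thm 5 for `N ≤ 1`, `m = 0`);
* `weightedConeClause_of_deviationCk_fin_zero` (`N = 0`): the weight is identically `1`
  (`⨅ over Fin 0 = 0` in `ℝ`), and the cone slab is part of the whole slab, so (11) follows from the
  unweighted whole-slab clause (10) `deviationCk B Φ 3 t → 0` with NO rate: the `N = 0` sub-case of
  the stub is closed (`stub_weightedConeDecayFinZero`: the stub's implication for witnesses with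
  `N = 0`, same moduli, chart and `O`; no trimming, admissibility or maximality needed).

References: Dafermos–Holzegel–Rodnianski–Taylor arXiv:2104.08222 §1 (the `Cᵏ` slab norms
`deviationCk`); Dafermos–Luk arXiv:1710.01722, Conjecture 1 (the clause list).
-/

noncomputable section

open scoped Manifold ContDiff Topology ENNReal BigOperators
open Filter Set TopologicalSpace MeasureTheory Function Literature.Geometry.Lorentzian InitialDataSet

-- the doubled `FinalStateConjecture.FinalStateConjecture` path component trips dupNamespace
set_option linter.dupNamespace false
set_option linter.style.longLine false

namespace Summit.FinalStateConjecture.FinalStateConjecture.Theorems.EIHFluxBalance.ConeRatesAreILED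

/-! ## §1 The weight `1 + d^{7/4}`: identically `1` for `N = 0`, at most `1 + ((κ+κ²)t)^{7/4}` in the cone -/

-- adapted from Cruxes/ModulatedKerrHandoff/Disproof.lean §6 `weight_fin_zero`
/-- For `N = 0` the cone weight `1 + d^{7/4}` is `1`: the distance to the nearest of NO centres is the
junk value `⨅ ∅ = 0` of `ℝ`. [folklore] -/
theorem weight_fin_zero (f : Fin 0 → ℝ) : ENNReal.ofReal (1 + √(√((⨅ i, f i) ^ 7))) = 1 := by
  rw [Real.iInf_of_isEmpty f]
  simp

/-- The weight is monotone in the distance: `0 ≤ d ≤ d'` gives `1 + d^{7/4} ≤ 1 + d'^{7/4}` in `ℝ≥0∞`.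
[folklore] -/
theorem weight_mono {d d' : ℝ} (hd : 0 ≤ d) (h : d ≤ d') :
    ENNReal.ofReal (1 + √(√(d ^ 7))) ≤ ENNReal.ofReal (1 + √(√(d' ^ 7))) := by
  gcongr

/-- Inside the cone `‖x̲‖ ≤ κt`, once every centre satisfies `‖ξᵢ(t)‖ ≤ κ²t`, the distance to the
nearest centre is at most `(κ + κ²)t` (for `N = 0` it is the junk `0 ≤ (κ + κ²)t`). [folklore] -/
theorem iInf_dist_le_of_cone {N : ℕ} (ξ : Fin N → ℝ → E3) {κ t : ℝ} (hκ : 0 ≤ κ) (ht : 0 ≤ t)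
    (hξ : ∀ i, ‖ξ i t‖ ≤ κ ^ 2 * t) {y : E3} (hy : ‖y‖ ≤ κ * t) :
    (⨅ i, ‖y - ξ i t‖) ≤ (κ + κ ^ 2) * t := by
  rcases isEmpty_or_nonempty (Fin N) with hN | hN
  · rw [Real.iInf_of_isEmpty]
    positivity
  · obtain ⟨i⟩ := hN
    have hbdd : BddBelow (Set.range fun j ↦ ‖y - ξ j t‖) :=
      ⟨0, Set.forall_mem_range.2 fun j ↦ norm_nonneg _⟩
    calc (⨅ j, ‖y - ξ j t‖) ≤ ‖y - ξ i t‖ := ciInf_le hbdd i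
      _ ≤ ‖y‖ + ‖ξ i t‖ := norm_sub_le _ _
      _ ≤ κ * t + κ ^ 2 * t := add_le_add hy (hξ i)
      _ = (κ + κ ^ 2) * t := by ring

/-- The cone weight is eventually dominated by the explicit rate weight `1 + ((κ + κ²)t)^{7/4}`,
uniformly on the cone slab. [folklore] -/
theorem weight_le_of_cone {N : ℕ} (ξ : Fin N → ℝ → E3) {κ t : ℝ} (hκ : 0 ≤ κ) (ht : 0 ≤ t)
    (hξ : ∀ i, ‖ξ i t‖ ≤ κ ^ 2 * t) {y : E3} (hy : ‖y‖ ≤ κ * t) :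
    ENNReal.ofReal (1 + √(√((⨅ i, ‖y - ξ i t‖) ^ 7))) ≤
      ENNReal.ofReal (1 + √(√(((κ + κ ^ 2) * t) ^ 7))) :=
  weight_mono (Real.iInf_nonneg fun _ ↦ norm_nonneg _) (iInf_dist_le_of_cone ξ hκ ht hξ hy)

/-! ## §2 The weighted cone clause from an unweighted cone RATE (every `N`) -/

/-- **(11) from a cone rate, every `N`.** For the painted centres `ξᵢ` eventually inside `‖ξᵢ(t)‖ ≤ κ²t`
(`0 ≤ κ`) and ANY field `F` on `E4` (in the stub: `F = deviationExtend B Φ = Φ^*g − G` extended by `0`):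
if `(1 + ((κ + κ²)t)^{7/4}) · sup_{x ∈ U, x⁰ = t, |x̲| ≤ κt} max_{m ≤ 3} ‖D^m F(x)‖ → 0`, then the crux's
weighted cone clause (11) holds for `F`. This is the honest shape of the missing analytic input for
`N ≥ 1`: an unweighted `C³` sup over the interior cone with the explicit rate `o(t^{-7/4})`. [folklore] -/
theorem weightedConeClause_of_coneRate {G : Type*} [NormedAddCommGroup G] [NormedSpace ℝ G]
    {N : ℕ} (ξ : Fin N → ℝ → E3) {κ : ℝ} (hκ : 0 ≤ κ) (hξ : ∀ i, ∀ᶠ t in atTop, ‖ξ i t‖ ≤ κ ^ 2 * t)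
    (U : Opens E4) (F : E4 → G) (k : ℕ)
    (hrate : Tendsto (fun t : ℝ ↦ ENNReal.ofReal (1 + √(√(((κ + κ ^ 2) * t) ^ 7))) *
      ⨆ x ∈ {x : U | x.1 0 = t ∧ E4.spatialNorm x.1 ≤ κ * t}, ⨆ (m : ℕ) (_ : m ≤ k),
        ‖iteratedFDeriv ℝ m F x.1‖ₑ) atTop (𝓝 0)) :
    Tendsto (fun t : ℝ ↦ ⨆ x ∈ {x : U | x.1 0 = t ∧ E4.spatialNorm x.1 ≤ κ * t}, ⨆ (m : ℕ) (_ : m ≤ k),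
      ENNReal.ofReal (1 + √(√((⨅ i, ‖E4.spatial x.1 - ξ i t‖) ^ 7))) * ‖iteratedFDeriv ℝ m F x.1‖ₑ)
      atTop (𝓝 0) := by
  refine tendsto_of_tendsto_of_tendsto_of_le_of_le' tendsto_const_nhds hrate
    (Eventually.of_forall fun _ ↦ zero_le) ?_
  filter_upwards [eventually_ge_atTop (0 : ℝ), eventually_all.2 hξ] with t ht hξt
  refine iSup₂_le fun x hx ↦ iSup₂_le fun m hm ↦ ?_
  gcongr ?_ * ?_
  · exact weight_le_of_cone ξ hκ ht hξt hx.2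
  · exact le_iSup_of_le x (le_iSup_of_le hx (le_iSup_of_le m (le_iSup_of_le hm le_rfl)))

/-! ## §3 `N = 0`: the weighted cone clause (11) from the whole-slab clause (10), no rate -/

/-- **(10) ⇒ (11) for `N = 0`, over the SAME `U, Φ, B, κ`.** For NO centres the weight is `1`
(`weight_fin_zero`) and the cone slab `{x ∈ U | x⁰ = t, |x̲| ≤ κt}` lies in the whole slab
`{x ∈ U | x⁰ = t}`, so the weighted cone supremum is at most `deviationCk B Φ 3 t`; hence the crux's
weighted clause (11) follows from its unweighted whole-slab clause (10). Stated for an arbitrary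
spacetime `𝓢` (in the stub: `𝓢 = 𝒟.toSpacetime`) and the crux's literal background `B` at `N = 0`.
[folklore] -/
theorem weightedConeClause_of_deviationCk_fin_zero : ∀ (𝓢 : Spacetime 4) (M a : Fin 0 → ℝ) (Λ : Fin 0 → ℝ → lorentzGroup) (ξ : Fin 0 → ℝ → E3) (κ : ℝ) (U : Opens E4) (Φ : U → 𝓢.carrier), let B : ModelBackground := ⟨U, fun x ↦ Minkowski.bilin + ∑ i, (boostedKerrBilin (Λ i (x 0)) (E4.ofTimeSpace (x 0) (ξ i (x 0))) (M i) (a i) x - Minkowski.bilin), fun x ↦ x 0, E4.spatialNorm⟩; Tendsto (fun t ↦ 𝓢.deviationCk B Φ 3 t) atTop (𝓝 0) → Tendsto (fun t : ℝ ↦ ⨆ x ∈ {x : U | x.1 0 = t ∧ E4.spatialNorm x.1 ≤ κ * t}, ⨆ (m : ℕ) (_ : m ≤ 3), ENNReal.ofReal (1 + √(√((⨅ i, ‖E4.spatial x.1 - ξ i t‖) ^ 7))) * ‖iteratedFDeriv ℝ m (𝓢.deviationExtend B Φ) x.1‖ₑ) atTop (𝓝 0) := by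
  intro 𝓢 M a Λ ξ κ U Φ B h10
  refine tendsto_of_tendsto_of_tendsto_of_le_of_le tendsto_const_nhds h10 (fun _ ↦ zero_le)
    fun t ↦ ?_
  refine iSup₂_le fun x hx ↦ iSup₂_le fun m hm ↦ ?_
  rw [weight_fin_zero, one_mul]
  exact enorm_iteratedFDeriv_le_supCkENorm hm (mem_image_of_mem Subtype.val (show x ∈ B.timeSlab t from hx.1)) _

/-! ## §4 The `N = 0` sub-case of the stub, closed (same moduli, chart and `O`) -/

-- operator-norm instance paths on form-valued maps are slow to unify
set_option synthInstance.maxHeartbeats 200000 in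
set_option maxHeartbeats 800000 in
/-- **`stub_weightedConeDecay` for witnesses with NO holes (sub-stub `stub_weightedConeDecayFinZero`).**
If a development `𝒟` is captured in the cone-capture sense by a witness with `N = 0` (an asymptotically
Minkowskian lab chart: clauses (1)–(6), (H), (K), (WR), (O) are vacuous, `B = η` on `U ⊇ {x⁰ > τ₀}`),
then it satisfies the weighted cone-capture ansatz — the conclusion of the stub verbatim — with the same
witness: clause (11) is `weightedConeClause_of_deviationCk_fin_zero` applied to clause (10). No trimming,
admissibility or maximality is used: the `N = 0` sub-case carries no rate. [folklore] -/
theorem stub_weightedConeDecayFinZero : ∀ (X : Type) [TopologicalSpace X] [ChartedSpace E3 X] [IsManifold (𝓡 3) ((⊤ : ℕ∞) : WithTop ℕ∞) X] [T2Space X] [SecondCountableTopology X] [ConnectedSpace X] (D : InitialDataSet (𝓡 3) X) (𝒟 : VacuumCauchyDevelopment D) (M a rin : Fin 0 → ℝ) (Λ : Fin 0 → ℝ → lorentzGroup) (ξ : Fin 0 → ℝ → E3) (γ κ τ₀ A : ℝ) (U : Opens E4) (Φ : U → 𝒟.carrier) (O : Set 𝒟.carrier), ((∀ i, Kerr.IsSubextremal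 (M i) (a i) ∧ Kerr.rMinus (M i) (a i) < rin i ∧ rin i < Kerr.rPlus (M i) (a i)) ∧ (∀ i t, |((Λ i t : E4 ≃L[ℝ] E4) (E4.basisVector 0)) 0| ≤ γ) ∧ (∀ i, ContDiff ℝ ((⊤ : ℕ∞) : WithTop ℕ∞) (ξ i) ∧ ContDiff ℝ ((⊤ : ℕ∞) : WithTop ℕ∞) (fun t ↦ ((Λ i t : E4 ≃L[ℝ] E4) : E4 →L[ℝ] E4))) ∧ (∀ i j, i ≠ j → Tendsto (fun t ↦ ‖ξ i t - ξ j t‖) atTop atTop) ∧ (∀ i j, i ≠ j → ∃ v : ℝ, 0 < v ∧ ∀ᶠ t in atTop, v * t ≤ ‖ξ i t - ξ j t‖) ∧ (∀ i t, τ₀ ≤ t → (∀ k, k ≤ 4 → ‖iteratedDeriv k (fun s ↦ ((Λ i s : E4 ≃L[ℝ] E4) : E4 →L[ℝ] E4)) t‖ ≤ A) ∧ ∀ k, 1 ≤ k → k ≤ 4 → ‖iteratedDeriv k (ξ i) t‖ ≤ A) ∧ (∀ i, Tendsto (fun t : ℝ ↦ t ^ (3 / 4 : ℝ) * ‖deriv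 (fun s ↦ (((Λ i s : lorentzGroup) : E4 ≃L[ℝ] E4) (E4.basisVector 0))) t‖) atTop (𝓝 0) ∧ (∃ V : ℝ, ∀ᶠ t in atTop, ‖deriv (ξ i) t‖ ≤ V) ∧ (∃ V₃ : ℝ, a i ≠ 0 → ∀ᶠ t in atTop, ‖deriv (fun s ↦ (((Λ i s : lorentzGroup) : E4 ≃L[ℝ] E4) (E4.basisVector 3))) t‖ ≤ V₃)) ∧ (0 < κ ∧ κ < 1 ∧ ∀ i, ∀ᶠ t in atTop, ‖ξ i t‖ ≤ κ ^ 2 * t) ∧ ({x : E4 | τ₀ < x 0 ∧ ∀ i, rin i < Kerr.radius (a i) (poincareInv (Λ i (x 0)) (E4.ofTimeSpace (x 0) (ξ i (x 0))) x)} ⊆ (U : Set E4)) ∧ let B : ModelBackground := ⟨U, fun x ↦ Minkowski.bilin + ∑ i, (boostedKerrBilin (Λ i (x 0)) (E4.ofTimeSpace (x 0) (ξ i (x 0))) (M i) (a i) x - Minkowski.bilin), fun x ↦ x 0, E4.spatialNorm⟩; ContMDiff 𝓘(ℝ, E4) (𝓡 4) ((⊤ : ℕ∞) : WithTop ℕ∞)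 Φ ∧ Topology.IsOpenEmbedding ((B.lateRegion τ₀).restrict Φ) ∧ Φ '' {x : U | τ₀ < x.1 0 ∧ ∀ i, Kerr.rPlus (M i) (a i) < Kerr.radius (a i) (poincareInv (Λ i (x.1 0)) (E4.ofTimeSpace (x.1 0) (ξ i (x.1 0))) x.1)} ⊆ O ∧ Tendsto (fun t ↦ 𝒟.toSpacetime.deviationCk B Φ 3 t) atTop (𝓝 0) ∧ O = Summit.FinalStateConjecture.exteriorOf 𝒟.toCauchyDevelopment (Φ '' {x : U | τ₀ < x.1 0 ∧ ∀ i, Kerr.rPlus (M i) (a i) < Kerr.radius (a i) (poincareInv (Λ i (x.1 0)) (E4.ofTimeSpace (x.1 0) (ξ i (x.1 0))) x.1)}) ∧ (∀ t₁ : ℝ, τ₀ < t₁ → O \ Φ '' {x : U | t₁ < x.1 0 ∧ ∀ i, Kerr.rPlus (M i) (a i) < Kerr.radius (a i) (poincareInv (Λ i (x.1 0)) (E4.ofTimeSpace (x.1 0) (ξ i (x.1 0))) x.1)} ⊆ 𝒟.metric.causalPast 𝒟.timeOrientation (Φ '' {x : U | x.1 0 = t₁ ∧ ∀ i, Kerr.rPlus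 (M i) (a i) < Kerr.radius (a i) (poincareInv (Λ i (x.1 0)) (E4.ofTimeSpace (x.1 0) (ξ i (x.1 0))) x.1)})) ∧ (∃ τ₁ : ℝ, ∀ x y : U, (τ₁ < x.1 0 ∧ ∀ i, rin i < Kerr.radius (a i) (poincareInv (Λ i (x.1 0)) (E4.ofTimeSpace (x.1 0) (ξ i (x.1 0))) x.1)) → (τ₁ < y.1 0 ∧ ∀ i, rin i < Kerr.radius (a i) (poincareInv (Λ i (y.1 0)) (E4.ofTimeSpace (y.1 0) (ξ i (y.1 0))) y.1)) → Φ y ∈ 𝒟.metric.causalFuture 𝒟.timeOrientation {Φ x} → x.1 0 ≤ y.1 0) ∧ (∀ (i : Fin 0) (t : ℝ), 0 < (((Λ i t : lorentzGroup) : E4 ≃L[ℝ] E4) (E4.basisVector 0)) 0) ∧ Summit.FinalStateConjecture.RaysStayInClosure 𝒟.toCauchyDevelopment O) → (∃ (N : ℕ) (M a rin : Fin N → ℝ) (Λ : Fin N → ℝ → lorentzGroup) (ξ : Fin N → ℝ → E3) (γ κ τ₀ A : ℝ) (U : Opens E4) (Φ : U → 𝒟.carrier) (O : Set 𝒟.carrier),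 (∀ i, Kerr.IsSubextremal (M i) (a i) ∧ Kerr.rMinus (M i) (a i) < rin i ∧ rin i < Kerr.rPlus (M i) (a i)) ∧ (∀ i t, |((Λ i t : E4 ≃L[ℝ] E4) (E4.basisVector 0)) 0| ≤ γ) ∧ (∀ i, ContDiff ℝ ((⊤ : ℕ∞) : WithTop ℕ∞) (ξ i) ∧ ContDiff ℝ ((⊤ : ℕ∞) : WithTop ℕ∞) (fun t ↦ ((Λ i t : E4 ≃L[ℝ] E4) : E4 →L[ℝ] E4))) ∧ (∀ i j, i ≠ j → Tendsto (fun t ↦ ‖ξ i t - ξ j t‖) atTop atTop) ∧ (∀ i j, i ≠ j → ∃ v : ℝ, 0 < v ∧ ∀ᶠ t in atTop, v * t ≤ ‖ξ i t - ξ j t‖) ∧ (∀ i t, τ₀ ≤ t → (∀ k, k ≤ 4 → ‖iteratedDeriv k (fun s ↦ ((Λ i s : E4 ≃L[ℝ] E4) : E4 →L[ℝ] E4)) t‖ ≤ A) ∧ ∀ k, 1 ≤ k → k ≤ 4 → ‖iteratedDeriv k (ξ i) t‖ ≤ A) ∧ (∀ i, Tendsto (fun t : ℝ ↦ t ^ (3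 / 4 : ℝ) * ‖deriv (fun s ↦ (((Λ i s : lorentzGroup) : E4 ≃L[ℝ] E4) (E4.basisVector 0))) t‖) atTop (𝓝 0) ∧ (∃ V : ℝ, ∀ᶠ t in atTop, ‖deriv (ξ i) t‖ ≤ V) ∧ (∃ V₃ : ℝ, a i ≠ 0 → ∀ᶠ t in atTop, ‖deriv (fun s ↦ (((Λ i s : lorentzGroup) : E4 ≃L[ℝ] E4) (E4.basisVector 3))) t‖ ≤ V₃)) ∧ (0 < κ ∧ κ < 1 ∧ ∀ i, ∀ᶠ t in atTop, ‖ξ i t‖ ≤ κ ^ 2 * t) ∧ ({x : E4 | τ₀ < x 0 ∧ ∀ i, rin i < Kerr.radius (a i) (poincareInv (Λ i (x 0)) (E4.ofTimeSpace (x 0) (ξ i (x 0))) x)} ⊆ (U : Set E4)) ∧ let B : ModelBackground := ⟨U, fun x ↦ Minkowski.bilin + ∑ i, (boostedKerrBilin (Λ i (x 0)) (E4.ofTimeSpace (x 0) (ξ i (x 0))) (M i) (a i) x - Minkowski.bilin), fun x ↦ x 0, E4.spatialNorm⟩; ContMDiff 𝓘(ℝ, E4) (𝓡 4) ((⊤ :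 ℕ∞) : WithTop ℕ∞) Φ ∧ Topology.IsOpenEmbedding ((B.lateRegion τ₀).restrict Φ) ∧ Φ '' {x : U | τ₀ < x.1 0 ∧ ∀ i, Kerr.rPlus (M i) (a i) < Kerr.radius (a i) (poincareInv (Λ i (x.1 0)) (E4.ofTimeSpace (x.1 0) (ξ i (x.1 0))) x.1)} ⊆ O ∧ Tendsto (fun t ↦ 𝒟.toSpacetime.deviationCk B Φ 3 t) atTop (𝓝 0) ∧ Tendsto (fun t : ℝ ↦ ⨆ x ∈ {x : U | x.1 0 = t ∧ E4.spatialNorm x.1 ≤ κ * t}, ⨆ (m : ℕ) (_ : m ≤ 3), ENNReal.ofReal (1 + √(√((⨅ i, ‖E4.spatial x.1 - ξ i t‖) ^ 7))) * ‖iteratedFDeriv ℝ m (𝒟.toSpacetime.deviationExtend B Φ) x.1‖ₑ) atTop (𝓝 0) ∧ O = Summit.FinalStateConjecture.exteriorOf 𝒟.toCauchyDevelopment (Φ '' {x : U | τ₀ < x.1 0 ∧ ∀ i, Kerr.rPlus (M i) (a i) < Kerr.radius (a i) (poincareInv (Λ i (x.1 0)) (E4.ofTimeSpace (x.1 0) (ξ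 i (x.1 0))) x.1)}) ∧ (∀ t₁ : ℝ, τ₀ < t₁ → O \ Φ '' {x : U | t₁ < x.1 0 ∧ ∀ i, Kerr.rPlus (M i) (a i) < Kerr.radius (a i) (poincareInv (Λ i (x.1 0)) (E4.ofTimeSpace (x.1 0) (ξ i (x.1 0))) x.1)} ⊆ 𝒟.metric.causalPast 𝒟.timeOrientation (Φ '' {x : U | x.1 0 = t₁ ∧ ∀ i, Kerr.rPlus (M i) (a i) < Kerr.radius (a i) (poincareInv (Λ i (x.1 0)) (E4.ofTimeSpace (x.1 0) (ξ i (x.1 0))) x.1)})) ∧ (∃ τ₁ : ℝ, ∀ x y : U, (τ₁ < x.1 0 ∧ ∀ i, rin i < Kerr.radius (a i) (poincareInv (Λ i (x.1 0)) (E4.ofTimeSpace (x.1 0) (ξ i (x.1 0))) x.1)) → (τ₁ < y.1 0 ∧ ∀ i, rin i < Kerr.radius (a i) (poincareInv (Λ i (y.1 0)) (E4.ofTimeSpace (y.1 0) (ξ i (y.1 0))) y.1)) → Φ y ∈ 𝒟.metric.causalFuture 𝒟.timeOrientation {Φ x} → x.1 0 ≤ y.1 0) ∧ (∀ (i : Fin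 N) (t : ℝ), 0 < (((Λ i t : lorentzGroup) : E4 ≃L[ℝ] E4) (E4.basisVector 0)) 0) ∧ Summit.FinalStateConjecture.RaysStayInClosure 𝒟.toCauchyDevelopment O) := by
  intro X _ _ _ _ _ _ D 𝒟 M a rin Λ ξ γ κ τ₀ A U Φ O h
  obtain ⟨h1, h2, h3, h4, hH, hK, hWR, h5, h6, hrest⟩ := h
  obtain ⟨h7, h8, h9, h10, h11, h12, hT, hO, hRays⟩ := hrest
  refine ⟨0, M, a, rin, Λ, ξ, γ, κ, τ₀, A, U, Φ, O, h1, h2, h3, h4, hH, hK, hWR, h5, h6, ?_⟩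
  intro B
  exact ⟨h7, h8, h9, h10, weightedConeClause_of_deviationCk_fin_zero 𝒟.toSpacetime M a Λ ξ κ U Φ h10,
    h11, h12, hT, hO, hRays⟩

end Summit.FinalStateConjecture.FinalStateConjecture.Theorems.EIHFluxBalance.ConeRatesAreILED

end
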